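import Summits.AtomisticToContinuum.Crystallization.Theorems.FrustratedLawDichotomyStrainedPatchHomEntryFitHcpCentredLeaf

/-!
# The IN-TREE SLAB-OUT PRUNE of the analytic-slab leaf: sub-boxes of the confined ξ-box lying outside the slab `{Q(x) ≤ t‖x‖}` are exempt for free
# (27623 `(H) HomFloor (1/625)`, hcp half; critic rows 1172 / 1175 «fresh-cert crossover cell»; hand-1 g31)

decomp-a2c hand-1 g31 (crux `AperiodicFrustratedLawGap`, stmt-AtomisticToContinuum-27623).  In `…HomEntryLeafHT4.entryLeafOKHT4` the analytic slab of
`…HomExemptZeroStep` / `…HomSlabConfine` confines the shuffle displacement `x = U(ξ − ξ₀)` (`ξ₀` = the ξ-centre of the cell) to the SLAB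
`Q(x) = (λ_T/SC)‖x‖² + Σ_ij (D_ij/SC) x_i x_j ≤ (htT/SC)‖x‖`, and the inner certificate sub-tree then runs over the coordinate BOX `htWr ⊇ slab` obtained from
it per coordinate by AM–GM.  MEASURED (hand-1 g31, float W-model at the `0.90 / 0.95 t_b` crossover cells, `U 2⁻¹²`): only `≈ 19 %` of the box volume lies
in the slab, and near the crossover the box corners OUTSIDE the slab carry identity-rotation misfits ABOVE the fit threshold (`0.0502 > 0.04999` at `0.95 t_b`)
— no inner fit verdict can ever close them, although the slab argument itself already exempts them.  This file puts the slab test INTO the sub-tree: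

* §1 `slabOut p c w c' w'` — interval check that a sub-box `(c', w')` (entries AND shuffles) lies strictly outside the slab of the cell `(c, w)`:
  `((htT)·√(‖x‖²)).hi < (λ_T‖x‖² + x·Dx).lo` on the enclosures `spX` (`x_i = Σ_j U_ij Δ_j`, `Δ_j = ξ_j − c_j/SC` over the sub-box), `spN2`, `spQ`;
  ★ `slabOut_sound`: then `(htT/SC)‖U(ξ − ξ₀)‖ < Q(U(ξ − ξ₀))` for every `(U, ξ)` of the sub-box;
* §2 ★ `entryLeafOKHT5 inner p t c w := htCertSide p c w && treeOK (fun c' w' => slabOut p c w c' w' || inner c' w') t c (htWr p c w)` and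
  ★★★ `entryLeafOKHT5_sound` — the hver-shape soundness for ANY sound inner verdict (proof = `entryLeafOKHT4_sound` with the slab inequality threaded
  through `…HomCertTree.treeOK_sound` as an extra hypothesis of the box predicate, discharged by `slabOut_sound` on pruned leaves);
* §3 the instance `entryLeafOKHT5QD μ` (inner = `…HomEntryFitHcpCentred.entryLeafOKHQD μ`: directional centred fit, else the quick hcp verdict) + `_sound`,
  the union `entryLeafOKHT5QDX μ P T` with payload functions + `_sound`, `hcpHalf_of_entryTreeHT5QDX`, ★★★ `homFloor_625_of_entryTrees6RBKP_HT5QDX`.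

Kernel definitions + soundness; 0 sorry; standard axioms; no instances / notation / `#eval`.  `--supports stmt-AtomisticToContinuum-27623`.
-/

noncomputable section

namespace Summit.AtomisticToContinuum.Crystallization.Theorems.FrustratedLawDichotomyStrainedPatchHomEntryLeafHT

open scoped BigOperators RealInnerProductSpace
open Literature.Analysis.ValidatedNumerics.Numerics
open Summit.AtomisticToContinuum.Crystallization.Theorems.ChargedEnergyGapNegative (E3)
open Summit.AtomisticToContinuum.Crystallization.Theorems.FrustratedLawDichotomySchurCut (effPot w₄₅ ω₄)
open Summit.AtomisticToContinuum.Crystallization.Theorems.FrustratedLawDichotomyAveragingRuleTightFree (TightNearCap BadNearCap)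
open Summit.AtomisticToContinuum.Crystallization.Theorems.FrustratedLawDichotomyExemptAbsorption (ExemptNear)
open Summit.AtomisticToContinuum.Crystallization.Theorems.FrustratedLawDichotomyStrainedPatchHomSplit (ExRec latPt hexFrame hcpShift HomFloor)
open Summit.AtomisticToContinuum.Crystallization.Theorems.FrustratedLawDichotomyStrainedPatchTaylorChord (segGd)
open Summit.AtomisticToContinuum.Crystallization.Theorems.FrustratedLawDichotomyStrainedPatchHomCoords (apply_eq_sum_entries)
open Summit.AtomisticToContinuum.Crystallization.Theorems.FrustratedLawDichotomyStrainedPatchHomEntryGram (entryFI mem_entryFI)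
open Summit.AtomisticToContinuum.Crystallization.Theorems.FrustratedLawDichotomyStrainedPatchHomEntryGramHcp (dot3 shufFI mem_dot3 mem_shufFI)
open Summit.AtomisticToContinuum.Crystallization.Theorems.FrustratedLawDichotomyStrainedPatchHomCurvCentreKit (cenShuf cenShuf_apply)
open Summit.AtomisticToContinuum.Crystallization.Theorems.FrustratedLawDichotomyStrainedPatchHomCurvLJ (curvCheckLJM)
open Summit.AtomisticToContinuum.Crystallization.Theorems.FrustratedLawDichotomyStrainedPatchHomForceJacN
  (fjQ fjE forceJacCheckN boxLabels11 boxLabels11_toFinset)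
open Summit.AtomisticToContinuum.Crystallization.Theorems.FrustratedLawDichotomyStrainedPatchHomForceHcp (xiBallOK norm_le_quarter_of_xiBallOK)
open Summit.AtomisticToContinuum.Crystallization.Theorems.FrustratedLawDichotomyStrainedPatchHomCurvLeafHCC (entryLeafOKHCCX entryLeafOKHCCX_sound)
open Summit.AtomisticToContinuum.Crystallization.Theorems.FrustratedLawDichotomyStrainedPatchHomSlabConfine (abs_apply_le_of_qcert)
open Summit.AtomisticToContinuum.Crystallization.Theorems.FrustratedLawDichotomyStrainedPatchHomSlabLeaf
  (jac_floorM_of_three_checks abs_coord_le_of_confined hver_of_slabParts)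
open Summit.AtomisticToContinuum.Crystallization.Theorems.FrustratedLawDichotomyStrainedPatchHomPrunedPolar (homFloor_of_prunedBoxSums_selfAdjoint)
open Summit.AtomisticToContinuum.Crystallization.Theorems.FrustratedLawDichotomyStrainedPatchHomCertTree (CertTree treeOK treeOK_sound)
open Summit.AtomisticToContinuum.Crystallization.Theorems.FrustratedLawDichotomyStrainedPatchHomEntryGram (rootC rootW)
open Summit.AtomisticToContinuum.Crystallization.Theorems.FrustratedLawDichotomyStrainedPatchHomEntryGramHcp (rootCH rootWH)
open Summit.AtomisticToContinuum.Crystallization.Theorems.FrustratedLawDichotomyStrainedPatchHomEntryTable (muRec muRec_ok)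
open Summit.AtomisticToContinuum.Crystallization.Theorems.FrustratedLawDichotomyStrainedPatchHomEntryTableP (entryLeafOK6RBKP)
open Summit.AtomisticToContinuum.Crystallization.Theorems.FrustratedLawDichotomyStrainedPatchHomEntryTreeCert (fccHalf_of_entryTree6RBKP)
open Summit.AtomisticToContinuum.Crystallization.Theorems.FrustratedLawDichotomyStrainedPatchHomEntryFlipHcp (HcpDich hcpHalf_of_entryTreeShuf)
open Summit.AtomisticToContinuum.Crystallization.Theorems.FrustratedLawDichotomyStrainedPatchHomEntryFitHcpCentred (entryLeafOKHQD entryLeafOKHQD_sound)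

/-! ## §1. The slab-out test on a sub-box and its soundness -/

/-- Interval of `Δ_j = ξ_j − c_j/SC` (displacement from the ξ-centre of the CELL `c`) over the shuffle part of the sub-box `(c', w')`. -/
def spD (c c' w' : (Fin 3 × Fin 3) ⊕ Fin 3 → ℤ) (j : Fin 3) : FI := (shufFI c' w' j).sub (FI.ofScaled (c (Sum.inr j)))

/-- Interval of `x_i = (U Δ)_i = Σ_j U_ij Δ_j` over the sub-box (entries of `U` from the sub-box). -/
def spX (c c' w' : (Fin 3 × Fin 3) ⊕ Fin 3 → ℤ) (i : Fin 3) : FI := dot3 (fun j => fjE c' w' (i, j)) (spD c c' w')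

/-- Interval of `‖x‖²`. -/
def spN2 (c c' w' : (Fin 3 × Fin 3) ⊕ Fin 3 → ℤ) : FI := dot3 (spX c c' w') (spX c c' w')

/-- Interval of `(D x)_i / SC = Σ_j (D_ij/SC) x_j`. -/
def spDX (p : HTCert) (c c' w' : (Fin 3 × Fin 3) ⊕ Fin 3 → ℤ) (i : Fin 3) : FI := dot3 (fun j => FI.ofScaled (p.D i j)) (spX c c' w')

/-- Interval of the Q-form `(λ_T/SC)‖x‖² + Σ_i x_i (Σ_j (D_ij/SC) x_j)`. -/
def spQ (p : HTCert) (c c' w' : (Fin 3 × Fin 3) ⊕ Fin 3 → ℤ) : FI :=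
  ((FI.ofScaled p.lamT).mul (spN2 c c' w')).add (dot3 (spX c c' w') (spDX p c c' w'))

/-- ★ **SLAB-OUT TEST**: the sub-box `(c', w')` of the cell `(c, w)` lies strictly outside the slab of the certificate `p`:
`((htT/SC)·√‖x‖²).hi < Q.lo` on the enclosures. -/
def slabOut (p : HTCert) (c w c' w' : (Fin 3 × Fin 3) ⊕ Fin 3 → ℤ) : Bool :=
  decide (((FI.ofScaled (htT p c w)).mul (FI.sqrt (spN2 c c' w'))).hi < (spQ p c c' w').lo)

/-- Three-term sum of products in `dot3`. [formal bookkeeping] -/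
theorem mem_dot3_real {x y : Fin 3 → ℝ} {A B : Fin 3 → FI} (hx : ∀ a, FI.mem (x a) (A a)) (hy : ∀ a, FI.mem (y a) (B a)) :
    FI.mem (x 0 * y 0 + x 1 * y 1 + x 2 * y 2) (dot3 A B) :=
  FI.mem_add (FI.mem_add (FI.mem_mul (hx 0) (hy 0)) (FI.mem_mul (hx 1) (hy 1))) (FI.mem_mul (hx 2) (hy 2))

/-- `spD` encloses the displacement coordinates. [formal bookkeeping] -/
theorem mem_spD {c c' w' : (Fin 3 × Fin 3) ⊕ Fin 3 → ℤ} {ξ : E3}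
    (hξ : ∀ i : Fin 3, |ξ i - (c' (Sum.inr i) : ℝ) / SC| ≤ (w' (Sum.inr i) : ℝ) / SC) (j : Fin 3) :
    FI.mem ((ξ - cenShuf c) j) (spD c c' w' j) := by
  rw [PiLp.sub_apply, cenShuf_apply]
  exact FI.mem_sub (mem_shufFI (hξ j)) (FI.mem_ofScaled _)

/-- `spX` encloses the displacement `x = U(ξ − ξ₀)` coordinatewise. [formal bookkeeping] -/
theorem mem_spX {c c' w' : (Fin 3 × Fin 3) ⊕ Fin 3 → ℤ} (U : E3 →L[ℝ] E3) {ξ : E3}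
    (hbox : ∀ ab : Fin 3 × Fin 3, |(U (EuclideanSpace.single ab.2 (1 : ℝ))) ab.1 - (c' (Sum.inl ab) : ℝ) / SC| ≤ (w' (Sum.inl ab) : ℝ) / SC)
    (hξ : ∀ i : Fin 3, |ξ i - (c' (Sum.inr i) : ℝ) / SC| ≤ (w' (Sum.inr i) : ℝ) / SC) (i : Fin 3) :
    FI.mem ((U (ξ - cenShuf c)) i) (spX c c' w' i) := by
  have hE : ∀ ab : Fin 3 × Fin 3, FI.mem ((U (EuclideanSpace.single ab.2 (1 : ℝ))) ab.1) (fjE c' w' ab) := fun ab => mem_entryFI (hbox ab)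
  rw [apply_eq_sum_entries, Fin.sum_univ_three]
  exact mem_dot3_real (x := fun j => (U (EuclideanSpace.single j (1 : ℝ))) i) (y := fun j => (ξ - cenShuf c) j)
    (fun j => hE (i, j)) (mem_spD hξ)

/-- ★ **SOUNDNESS OF THE SLAB-OUT TEST**: on a pruned sub-box the slab inequality fails strictly. [folklore: interval arithmetic] -/
theorem slabOut_sound {p : HTCert} {c w c' w' : (Fin 3 × Fin 3) ⊕ Fin 3 → ℤ} (h : slabOut p c w c' w' = true) (U : E3 →L[ℝ] E3) (ξ : E3)
    (hbox : ∀ ab : Fin 3 × Fin 3, |(U (EuclideanSpace.single ab.2 (1 : ℝ))) ab.1 - (c' (Sum.inl ab) : ℝ) / SC| ≤ (w' (Sum.inl ab) : ℝ) / SC)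
    (hξ : ∀ i : Fin 3, |ξ i - (c' (Sum.inr i) : ℝ) / SC| ≤ (w' (Sum.inr i) : ℝ) / SC) :
    (htT p c w : ℝ) / SC * ‖U (ξ - cenShuf c)‖ <
      (p.lamT : ℝ) / SC * ‖U (ξ - cenShuf c)‖ ^ 2 +
        ∑ i : Fin 3, ∑ j : Fin 3, (p.D i j : ℝ) / SC * ((U (ξ - cenShuf c)) i * (U (ξ - cenShuf c)) j) := by
  have hS : (0 : ℝ) < SC := by norm_num [SC]
  set x : E3 := U (ξ - cenShuf c) with hxdef
  have hx : ∀ i, FI.mem (x i) (spX c c' w' i) := mem_spX U hbox hξ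
  have hN : FI.mem (‖x‖ ^ 2) (spN2 c c' w') := by
    rw [← real_inner_self_eq_norm_sq]
    exact mem_dot3 hx hx
  have hsq : FI.mem ‖x‖ (FI.sqrt (spN2 c c' w')) := by
    have := FI.mem_sqrt hN
    rwa [Real.sqrt_sq (norm_nonneg _)] at this
  have hL : FI.mem ((htT p c w : ℝ) / SC * ‖x‖) ((FI.ofScaled (htT p c w)).mul (FI.sqrt (spN2 c c' w'))) :=
    FI.mem_mul (FI.mem_ofScaled _) hsq
  have hDX : ∀ i, FI.mem ((p.D i 0 : ℝ) / SC * x 0 + (p.D i 1 : ℝ) / SC * x 1 + (p.D i 2 : ℝ) / SC * x 2) (spDX p c c' w' i) := fun i =>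
    mem_dot3_real (x := fun j => (p.D i j : ℝ) / SC) (y := fun j => x j) (fun j => FI.mem_ofScaled _) hx
  have hQ : FI.mem ((p.lamT : ℝ) / SC * ‖x‖ ^ 2 +
      (x 0 * ((p.D 0 0 : ℝ) / SC * x 0 + (p.D 0 1 : ℝ) / SC * x 1 + (p.D 0 2 : ℝ) / SC * x 2) +
        x 1 * ((p.D 1 0 : ℝ) / SC * x 0 + (p.D 1 1 : ℝ) / SC * x 1 + (p.D 1 2 : ℝ) / SC * x 2) +
        x 2 * ((p.D 2 0 : ℝ) / SC * x 0 + (p.D 2 1 : ℝ) / SC * x 1 + (p.D 2 2 : ℝ) / SC * x 2))) (spQ p c c' w') :=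
    FI.mem_add (FI.mem_mul (FI.mem_ofScaled _) hN)
      (mem_dot3_real (x := fun j => x j)
        (y := fun i => (p.D i 0 : ℝ) / SC * x 0 + (p.D i 1 : ℝ) / SC * x 1 + (p.D i 2 : ℝ) / SC * x 2) hx hDX)
  have e : ∑ i : Fin 3, ∑ j : Fin 3, (p.D i j : ℝ) / SC * (x i * x j) =
      x 0 * ((p.D 0 0 : ℝ) / SC * x 0 + (p.D 0 1 : ℝ) / SC * x 1 + (p.D 0 2 : ℝ) / SC * x 2) +
        x 1 * ((p.D 1 0 : ℝ) / SC * x 0 + (p.D 1 1 : ℝ) / SC * x 1 + (p.D 1 2 : ℝ) / SC * x 2) +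
        x 2 * ((p.D 2 0 : ℝ) / SC * x 0 + (p.D 2 1 : ℝ) / SC * x 1 + (p.D 2 2 : ℝ) / SC * x 2) := by
    simp only [Fin.sum_univ_three]
    ring
  rw [e]
  have h' : ((FI.ofScaled (htT p c w)).mul (FI.sqrt (spN2 c c' w'))).hi < (spQ p c c' w').lo := by
    simpa [slabOut] using h
  have h1 := hL.2
  have h2 := hQ.1
  have h3 : ((((FI.ofScaled (htT p c w)).mul (FI.sqrt (spN2 c c' w'))).hi : ℤ) : ℝ) < (((spQ p c c' w').lo : ℤ) : ℝ) := by
    exact_mod_cast h'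
  exact lt_of_mul_lt_mul_right (h1.trans_lt (h3.trans_le h2)) hS.le

/-! ## §2. The slab leaf with the prune in the sub-tree, and its soundness -/

/-- ★ **THE ANALYTIC-SLAB LEAF WITH THE IN-TREE SLAB-OUT PRUNE**: certificate side ∧ `treeOK (slabOut ∨ inner) t` on the rounded confined box. -/
def entryLeafOKHT5 (inner : ((Fin 3 × Fin 3) ⊕ Fin 3 → ℤ) → ((Fin 3 × Fin 3) ⊕ Fin 3 → ℤ) → Bool) (p : HTCert) (t : CertTree ((Fin 3 × Fin 3) ⊕ Fin 3))
    (c w : (Fin 3 × Fin 3) ⊕ Fin 3 → ℤ) : Bool :=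
  htCertSide p c w && treeOK (fun c' w' => slabOut p c w c' w' || inner c' w') t c (htWr p c w)

/-- ★★★ **SOUNDNESS OF `entryLeafOKHT5` IN THE hver SHAPE, FOR ANY SOUND INNER VERDICT.** [folklore chaining: `entryLeafOKHT4_sound` with the slab
inequality carried into the box predicate of `…HomCertTree.treeOK_sound`; pruned leaves contradict it by `slabOut_sound`] -/
theorem entryLeafOKHT5_sound {μ : ℤ} {inner : ((Fin 3 × Fin 3) ⊕ Fin 3 → ℤ) → ((Fin 3 × Fin 3) ⊕ Fin 3 → ℤ) → Bool}
    (hinner : ∀ c w, inner c w = true → ∀ (U : E3 →L[ℝ] E3) (ξ : E3), (∀ v v' : E3, ⟪U v, v'⟫ = ⟪v, U v'⟫) → ‖U - 1‖ ≤ 1 / 4 →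
      (∀ ab : Fin 3 × Fin 3, |(U (EuclideanSpace.single ab.2 (1 : ℝ))) ab.1 - (c (Sum.inl ab) : ℝ) / SC| ≤ (w (Sum.inl ab) : ℝ) / SC) →
      (∀ i : Fin 3, |ξ i - (c (Sum.inr i) : ℝ) / SC| ≤ (w (Sum.inr i) : ℝ) / SC) → 0 ≤ ξ 0 → 0 ≤ ξ 2 →
      (∀ (M : ℕ) (z : Fin M → E3) (cc : Fin M), Function.Injective z →
          Set.range z = {x : E3 | dist x (z cc) ≤ 133 / 10 ∧ ∃ a : Fin 3 → ℤ,
            x = z cc + latPt U hexFrame a ∨ x = z cc + latPt U hexFrame a + U (hcpShift + ξ)} →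
          TightNearCap (9 / 5) (3 / 2) z cc ∨ ExemptNear (9 / 5) ExRec z cc ∨ BadNearCap (9 / 5) (3 / 2) z cc) ∨
        (μ : ℝ) / SC ≤ ∑ b ∈ (Fintype.piFinset fun _ : Fin 3 => Finset.Icc (-7 : ℤ) 7).filter (fun b => b ≠ 0), effPot w₄₅ ω₄ (3 / 400) ‖latPt U hexFrame b‖ +
          ∑ b ∈ (Fintype.piFinset fun _ : Fin 3 => Finset.Icc (-7 : ℤ) 7), effPot w₄₅ ω₄ (3 / 400) ‖latPt U hexFrame b + U (hcpShift + ξ)‖)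
    {p : HTCert} {t : CertTree ((Fin 3 × Fin 3) ⊕ Fin 3)} {c w : (Fin 3 × Fin 3) ⊕ Fin 3 → ℤ} (h : entryLeafOKHT5 inner p t c w = true) (U : E3 →L[ℝ] E3) (ξ : E3)
    (hsa : ∀ v v' : E3, ⟪U v, v'⟫ = ⟪v, U v'⟫) (hU : ‖U - 1‖ ≤ 1 / 4)
    (hbox : ∀ ab : Fin 3 × Fin 3, |(U (EuclideanSpace.single ab.2 (1 : ℝ))) ab.1 - (c (Sum.inl ab) : ℝ) / SC| ≤ (w (Sum.inl ab) : ℝ) / SC)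
    (hξ : ∀ i : Fin 3, |ξ i - (c (Sum.inr i) : ℝ) / SC| ≤ (w (Sum.inr i) : ℝ) / SC) (h0 : 0 ≤ ξ 0) (h2 : 0 ≤ ξ 2) :
    (∀ (M : ℕ) (z : Fin M → E3) (cc : Fin M), Function.Injective z →
        Set.range z = {x : E3 | dist x (z cc) ≤ 133 / 10 ∧ ∃ a : Fin 3 → ℤ,
          x = z cc + latPt U hexFrame a ∨ x = z cc + latPt U hexFrame a + U (hcpShift + ξ)} →
        TightNearCap (9 / 5) (3 / 2) z cc ∨ ExemptNear (9 / 5) ExRec z cc ∨ BadNearCap (9 / 5) (3 / 2) z cc) ∨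
      (μ : ℝ) / SC ≤ ∑ b ∈ (Fintype.piFinset fun _ : Fin 3 => Finset.Icc (-7 : ℤ) 7).filter (fun b => b ≠ 0), effPot w₄₅ ω₄ (3 / 400) ‖latPt U hexFrame b‖ +
        ∑ b ∈ (Fintype.piFinset fun _ : Fin 3 => Finset.Icc (-7 : ℤ) 7), effPot w₄₅ ω₄ (3 / 400) ‖latPt U hexFrame b + U (hcpShift + ξ)‖ := by
  classical
  have hS : (0 : ℝ) < SC := by norm_num [SC]
  unfold entryLeafOKHT5 htCertSide at h
  simp only [Bool.and_eq_true, decide_eq_true_eq] at h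
  obtain ⟨⟨⟨⟨⟨⟨⟨⟨hball, hROK⟩, hcert⟩, hcurvM⟩, hfar1⟩, hfar2⟩, ⟨⟨hs1, hs2⟩, hs3⟩⟩, hGs⟩, htree⟩ := h
  obtain ⟨hT, hγ, hr, hconf⟩ := htCertOK_spec hcert
  -- the reference shuffle: the ξ-centre of the cell
  set ξ₀ : E3 := cenShuf c with hξ₀def
  have hw0 : ∀ i : Fin 3, (0 : ℝ) ≤ (w (Sum.inr i) : ℝ) / SC := fun i => (abs_nonneg _).trans (hξ i)
  have hξ₀box : ∀ i : Fin 3, |ξ₀ i - (c (Sum.inr i) : ℝ) / SC| ≤ (w (Sum.inr i) : ℝ) / SC := by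
    intro i; rw [hξ₀def, cenShuf_apply, sub_self, abs_zero]; exact hw0 i
  have hn : ‖ξ‖ ≤ 1 / 4 := norm_le_quarter_of_xiBallOK hball hξ
  have hn₀ : ‖ξ₀‖ ≤ 1 / 4 := norm_le_quarter_of_xiBallOK hball hξ₀box
  -- label finsets
  set B : Finset (Fin 3 → ℤ) := (htB c w).toFinset with hBdef
  set R : Finset (Fin 3 → ℤ) := (htR c w).toFinset with hRdef
  have hB : B ⊆ Fintype.piFinset fun _ : Fin 3 => Finset.Icc (-11 : ℤ) 11 := by
    intro b hb
    rw [← boxLabels11_toFinset]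
    exact List.mem_toFinset.2 (mem_boxLabels11_of_mem_htB (List.mem_toFinset.1 hb))
  have hBin : ∀ bb ∈ B, ‖latPt U hexFrame bb + U (hcpShift + ξ)‖ ≤ 7 :=
    fun bb hbb => norm_le_seven_of_htIn U hbox ξ hξ (htIn_of_mem_htB (List.mem_toFinset.1 hbb))
  have hR : ∀ bb ∈ (Fintype.piFinset fun _ : Fin 3 => Finset.Icc (-11 : ℤ) 11) \ B, ‖latPt U hexFrame bb + U (hcpShift + ξ)‖ ≤ 7 →
      bb ∈ R ∧ 6 ≤ ‖latPt U hexFrame bb + U (hcpShift + ξ)‖ := by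
    intro bb hbb h7
    obtain ⟨hbox11, hnotB⟩ := Finset.mem_sdiff.1 hbb
    rw [← boxLabels11_toFinset] at hbox11
    have hbL : bb ∈ boxLabels11 := List.mem_toFinset.1 hbox11
    have hlo := lo_le_of_norm_le_seven U hbox ξ hξ h7
    by_cases hin : htIn c w bb = true
    · exact absurd (List.mem_toFinset.2 (mem_htB_of_htIn hbL hin)) hnotB
    · have hmemR : bb ∈ htR c w := by
        refine List.mem_filter.2 ⟨hbL, ?_⟩
        simp only [Bool.and_eq_true, Bool.not_eq_true', decide_eq_true_eq]
        exact ⟨by simpa using hin, hlo⟩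
      have h36 : 36 * (SC : ℤ) ≤ (fjQ c w bb).lo := by
        have := List.all_eq_true.1 hROK bb hmemR
        simpa using this
      exact ⟨List.mem_toFinset.2 hmemR, six_le_norm_of_lo U hbox ξ hξ h36⟩
  -- the Q-floor along the segment
  have hcurv : ∀ s ∈ Set.Ioo (0 : ℝ) 1,
      ((p.lam₁ + p.lam₂ + p.lam₃ : ℤ) : ℝ) / SC * ‖U (ξ - ξ₀)‖ ^ 2 + ∑ i : Fin 3, ∑ j : Fin 3, (p.D i j : ℝ) / SC * ((U (ξ - ξ₀)) i * (U (ξ - ξ₀)) j) ≤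
        ∑ bb ∈ B, segGd (fun x : ℝ => x⁻¹ ^ 7 - x⁻¹ ^ 13) (latPt U hexFrame bb + U (hcpShift + ξ₀)) (U (ξ - ξ₀)) s :=
    fun s hs => jac_floorM_of_three_checks (htB_nodup c w) hcurvM hfar1 hfar2 U hU hbox ξ₀ ξ hξ₀box hξ hn₀ hn hs
  -- the reference force bound, chunked
  have hf₀ : |∑ bb ∈ B, (‖latPt U hexFrame bb + U (hcpShift + ξ₀)‖⁻¹ ^ 8 - ‖latPt U hexFrame bb + U (hcpShift + ξ₀)‖⁻¹ ^ 14) *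
      ⟪latPt U hexFrame bb + U (hcpShift + ξ₀), U (ξ - ξ₀)⟫| ≤ (p.Gs : ℝ) / SC * ‖U (ξ - ξ₀)‖ := by
    have key := refForce_htB_le hs1 hs2 hs3 U hU hbox hn₀ ξ
    refine key.trans (mul_le_mul_of_nonneg_right ?_ (norm_nonneg _))
    rw [div_le_div_iff_of_pos_right hS]
    exact_mod_cast hGs
  -- slab ⟹ confinement ⟹ the pruned inner tree on the confined box
  have hslab : ((p.lam₁ + p.lam₂ + p.lam₃ : ℤ) : ℝ) / SC * ‖U (ξ - ξ₀)‖ ^ 2 +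
        ∑ i : Fin 3, ∑ j : Fin 3, (p.D i j : ℝ) / SC * ((U (ξ - ξ₀)) i * (U (ξ - ξ₀)) j) ≤
      ((6000 / 343 * (7 : ℝ)⁻¹ ^ 4 + 2880 / 49 * (7 : ℝ)⁻¹ ^ 5 + 10 / 7 * (7 : ℝ)⁻¹ ^ 6 + 2 * (7 : ℝ)⁻¹ ^ 7) + (p.Gs : ℝ) / SC +
        R.card * (6 : ℝ)⁻¹ ^ 7) * ‖U (ξ - ξ₀)‖ →
      (∀ (M : ℕ) (z : Fin M → E3) (cc : Fin M), Function.Injective z →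
          Set.range z = {x : E3 | dist x (z cc) ≤ 133 / 10 ∧ ∃ a : Fin 3 → ℤ,
            x = z cc + latPt U hexFrame a ∨ x = z cc + latPt U hexFrame a + U (hcpShift + ξ)} →
          TightNearCap (9 / 5) (3 / 2) z cc ∨ ExemptNear (9 / 5) ExRec z cc ∨ BadNearCap (9 / 5) (3 / 2) z cc) ∨
        (μ : ℝ) / SC ≤ ∑ b ∈ (Fintype.piFinset fun _ : Fin 3 => Finset.Icc (-7 : ℤ) 7).filter (fun b => b ≠ 0), effPot w₄₅ ω₄ (3 / 400) ‖latPt U hexFrame b‖ +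
          ∑ b ∈ (Fintype.piFinset fun _ : Fin 3 => Finset.Icc (-7 : ℤ) 7), effPot w₄₅ ω₄ (3 / 400) ‖latPt U hexFrame b + U (hcpShift + ξ)‖ := by
    intro hq
    have ht0 : (0 : ℝ) < (htT p c w : ℝ) / SC := div_pos (by exact_mod_cast hT) hS
    have hle := slabConst_le_htT p c w
    have hQ : (p.lamT : ℝ) / SC * ‖U (ξ - ξ₀)‖ ^ 2 + ∑ i : Fin 3, ∑ j : Fin 3, (p.D i j : ℝ) / SC * ((U (ξ - ξ₀)) i * (U (ξ - ξ₀)) j) ≤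
        (htT p c w : ℝ) / SC * ‖U (ξ - ξ₀)‖ := by
      have e : (p.lamT : ℝ) = ((p.lam₁ + p.lam₂ + p.lam₃ : ℤ) : ℝ) := by simp [HTCert.lamT]
      rw [e]
      exact hq.trans (mul_le_mul_of_nonneg_right hle (norm_nonneg _))
    have hΔk : ∀ k : Fin 3, |(U (ξ - ξ₀)) k| ≤ (p.rS k : ℝ) / SC := fun k =>
      abs_apply_le_of_qcert (Q := fun x : E3 => (p.lamT : ℝ) / SC * ‖x‖ ^ 2 + ∑ i : Fin 3, ∑ j : Fin 3, (p.D i j : ℝ) / SC * (x i * x j))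
        ht0 (div_pos (by exact_mod_cast hγ k) hS) (div_nonneg (by exact_mod_cast hr k) hS.le) k (fun x => htConf_sound (hconf k) x) hQ
    have hy := fun k => abs_coord_le_of_confined hU (ξ - ξ₀) (r := fun j => (p.rS j : ℝ) / SC) (κ := fun k => (htκ c w k : ℝ) / SC) hΔk
      (rowDev_le U hbox) k
    -- the confined box
    have hξ' : ∀ i : Fin 3, |ξ i - (c (Sum.inr i) : ℝ) / SC| ≤ (htW p c w (Sum.inr i) : ℝ) / SC := by
      intro i
      have hyi := hy i
      have e1 : (ξ - ξ₀) i = ξ i - (c (Sum.inr i) : ℝ) / SC := by rw [PiLp.sub_apply, hξ₀def, cenShuf_apply]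
      rw [e1] at hyi
      refine hyi.trans ?_
      rw [htW_inr]
      have hρ := sqrt_le_htρ p
      have hκ0 : (0 : ℝ) ≤ (htκ c w i : ℝ) / SC :=
        (Finset.sum_nonneg fun j _ => abs_nonneg _).trans (rowDev_le U hbox i)
      have hρ0 : (0 : ℝ) ≤ (htρ p : ℝ) := by
        have := (Real.sqrt_nonneg _).trans hρ
        rw [le_div_iff₀ hS, zero_mul] at this; exact this
      have hcd := div_le_cdiv (a := htκ c w i * 4 * htρ p) (b := 3 * (SC : ℤ)) (by norm_num [SC])
      have step : (htκ c w i : ℝ) / SC * (4 / 3 * Real.sqrt (∑ j : Fin 3, ((p.rS j : ℝ) / SC) ^ 2)) ≤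
          ((cdiv (htκ c w i * 4 * htρ p) (3 * SC) : ℤ) : ℝ) / SC := by
        have h1 : (htκ c w i : ℝ) / SC * (4 / 3 * Real.sqrt (∑ j : Fin 3, ((p.rS j : ℝ) / SC) ^ 2)) ≤
            (htκ c w i : ℝ) / SC * (4 / 3 * ((htρ p : ℝ) / SC)) := by gcongr
        refine h1.trans ?_
        rw [le_div_iff₀ hS]
        have e : (htκ c w i : ℝ) / SC * (4 / 3 * ((htρ p : ℝ) / SC)) * SC = ((htκ c w i * 4 * htρ p : ℤ) : ℝ) / ((3 * (SC : ℤ) : ℤ) : ℝ) := by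
          push_cast; field_simp
        rw [e]; exact hcd
      push_cast
      rw [add_div]
      linarith
    -- the point `(U_ab, ξ_i)` lies in the rounded confined box; run the PRUNED inner certificate tree there, carrying the slab inequality `hQ`
    have hx : ∀ k, |(Sum.elim (fun ab : Fin 3 × Fin 3 => (U (EuclideanSpace.single ab.2 (1 : ℝ))) ab.1) (fun i : Fin 3 => ξ i) k) -
        (c k : ℝ) / SC| ≤ (htWr p c w k : ℝ) / SC := by
      intro k
      rcases k with ab | i
      · exact hbox ab
      · refine (hξ' i).trans ?_
        rw [div_le_div_iff_of_pos_right hS]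
        exact_mod_cast htW_le_htWr p c w i
    have key := treeOK_sound SC_pos
      (P := fun x : (Fin 3 × Fin 3) ⊕ Fin 3 → ℝ => ∀ (V : E3 →L[ℝ] E3) (η : E3), (∀ v v' : E3, ⟪V v, v'⟫ = ⟪v, V v'⟫) → ‖V - 1‖ ≤ 1 / 4 →
        (∀ ab : Fin 3 × Fin 3, (V (EuclideanSpace.single ab.2 (1 : ℝ))) ab.1 = x (Sum.inl ab)) → (∀ i : Fin 3, η i = x (Sum.inr i)) → 0 ≤ η 0 → 0 ≤ η 2 →
        (p.lamT : ℝ) / SC * ‖V (η - cenShuf c)‖ ^ 2 +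
            ∑ i : Fin 3, ∑ j : Fin 3, (p.D i j : ℝ) / SC * ((V (η - cenShuf c)) i * (V (η - cenShuf c)) j) ≤
          (htT p c w : ℝ) / SC * ‖V (η - cenShuf c)‖ →
        (∀ (M : ℕ) (z : Fin M → E3) (cc : Fin M), Function.Injective z →
            Set.range z = {x : E3 | dist x (z cc) ≤ 133 / 10 ∧ ∃ a : Fin 3 → ℤ,
              x = z cc + latPt V hexFrame a ∨ x = z cc + latPt V hexFrame a + V (hcpShift + η)} →
            TightNearCap (9 / 5) (3 / 2) z cc ∨ ExemptNear (9 / 5) ExRec z cc ∨ BadNearCap (9 / 5) (3 / 2) z cc) ∨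
          (μ : ℝ) / SC ≤ ∑ b ∈ (Fintype.piFinset fun _ : Fin 3 => Finset.Icc (-7 : ℤ) 7).filter (fun b => b ≠ 0), effPot w₄₅ ω₄ (3 / 400) ‖latPt V hexFrame b‖ +
            ∑ b ∈ (Fintype.piFinset fun _ : Fin 3 => Finset.Icc (-7 : ℤ) 7), effPot w₄₅ ω₄ (3 / 400) ‖latPt V hexFrame b + V (hcpShift + η)‖)
      (fun c' w' => slabOut p c w c' w' || inner c' w')
      (fun c' w' hv x hx' V η hVsa hV1 hVx hηx h0' h2' hQ' => by
        have hVb : ∀ ab : Fin 3 × Fin 3, |(V (EuclideanSpace.single ab.2 (1 : ℝ))) ab.1 - (c' (Sum.inl ab) : ℝ) / SC| ≤ (w' (Sum.inl ab) : ℝ) / SC :=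
          fun ab => by rw [hVx ab]; exact hx' (Sum.inl ab)
        have hηb : ∀ i : Fin 3, |η i - (c' (Sum.inr i) : ℝ) / SC| ≤ (w' (Sum.inr i) : ℝ) / SC := fun i => by rw [hηx i]; exact hx' (Sum.inr i)
        simp only [Bool.or_eq_true] at hv
        rcases hv with hso | hin
        · exact absurd hQ' (not_le.2 (slabOut_sound hso V η hVb hηb))
        · exact hinner c' w' hin V η hVsa hV1 hVb hηb h0' h2')
      t c (htWr p c w) htree _ hx U ξ hsa hU (fun _ => rfl) (fun _ => rfl) h0 h2 hQ
    exact key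
  exact hver_of_slabParts hU hn₀ hn B R hB hBin hR hcurv hf₀ hslab

/-! ## §3. The instance of record (directional centred fit inside), the union with payload functions, the booking -/

/-- ★ The pruned slab leaf with inner sub-tree verdict `entryLeafOKHQD μ`. -/
def entryLeafOKHT5QD (μ : ℤ) (p : HTCert) (t : CertTree ((Fin 3 × Fin 3) ⊕ Fin 3)) (c w : (Fin 3 × Fin 3) ⊕ Fin 3 → ℤ) : Bool :=
  entryLeafOKHT5 (entryLeafOKHQD μ) p t c w

/-- ★★ Soundness of `entryLeafOKHT5QD` in the hver shape. [folklore chaining: `entryLeafOKHT5_sound` with `entryLeafOKHQD_sound`] -/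
theorem entryLeafOKHT5QD_sound {μ : ℤ} {p : HTCert} {t : CertTree ((Fin 3 × Fin 3) ⊕ Fin 3)} {c w : (Fin 3 × Fin 3) ⊕ Fin 3 → ℤ}
    (h : entryLeafOKHT5QD μ p t c w = true) (U : E3 →L[ℝ] E3) (ξ : E3)
    (hsa : ∀ v v' : E3, ⟪U v, v'⟫ = ⟪v, U v'⟫) (hU : ‖U - 1‖ ≤ 1 / 4)
    (hbox : ∀ ab : Fin 3 × Fin 3, |(U (EuclideanSpace.single ab.2 (1 : ℝ))) ab.1 - (c (Sum.inl ab) : ℝ) / SC| ≤ (w (Sum.inl ab) : ℝ) / SC)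
    (hξ : ∀ i : Fin 3, |ξ i - (c (Sum.inr i) : ℝ) / SC| ≤ (w (Sum.inr i) : ℝ) / SC) (h0 : 0 ≤ ξ 0) (h2 : 0 ≤ ξ 2) :
    (∀ (M : ℕ) (z : Fin M → E3) (cc : Fin M), Function.Injective z →
        Set.range z = {x : E3 | dist x (z cc) ≤ 133 / 10 ∧ ∃ a : Fin 3 → ℤ,
          x = z cc + latPt U hexFrame a ∨ x = z cc + latPt U hexFrame a + U (hcpShift + ξ)} →
        TightNearCap (9 / 5) (3 / 2) z cc ∨ ExemptNear (9 / 5) ExRec z cc ∨ BadNearCap (9 / 5) (3 / 2) z cc) ∨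
      (μ : ℝ) / SC ≤ ∑ b ∈ (Fintype.piFinset fun _ : Fin 3 => Finset.Icc (-7 : ℤ) 7).filter (fun b => b ≠ 0), effPot w₄₅ ω₄ (3 / 400) ‖latPt U hexFrame b‖ +
        ∑ b ∈ (Fintype.piFinset fun _ : Fin 3 => Finset.Icc (-7 : ℤ) 7), effPot w₄₅ ω₄ (3 / 400) ‖latPt U hexFrame b + U (hcpShift + ξ)‖ :=
  entryLeafOKHT5_sound (fun c' w' hv V η hVsa hV1 hVb hη h0' h2' => entryLeafOKHQD_sound c' w' hv V η hVsa hV1 hVb hη h0' h2') h U ξ hsa hU hbox hξ h0 h2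

/-- ★ The union verdict with payload FUNCTIONS (certificate `P c w`, inner sub-tree `T c w`), else the union verdict of record `entryLeafOKHCCX μ`. -/
def entryLeafOKHT5QDX (μ : ℤ) (P : ((Fin 3 × Fin 3) ⊕ Fin 3 → ℤ) → ((Fin 3 × Fin 3) ⊕ Fin 3 → ℤ) → HTCert)
    (T : ((Fin 3 × Fin 3) ⊕ Fin 3 → ℤ) → ((Fin 3 × Fin 3) ⊕ Fin 3 → ℤ) → CertTree ((Fin 3 × Fin 3) ⊕ Fin 3))
    (c w : (Fin 3 × Fin 3) ⊕ Fin 3 → ℤ) : Bool :=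
  entryLeafOKHT5QD μ (P c w) (T c w) c w || entryLeafOKHCCX μ c w

/-- ★★ Soundness of `entryLeafOKHT5QDX` in the hver shape. [folklore chaining] -/
theorem entryLeafOKHT5QDX_sound {μ : ℤ} {P : ((Fin 3 × Fin 3) ⊕ Fin 3 → ℤ) → ((Fin 3 × Fin 3) ⊕ Fin 3 → ℤ) → HTCert}
    {T : ((Fin 3 × Fin 3) ⊕ Fin 3 → ℤ) → ((Fin 3 × Fin 3) ⊕ Fin 3 → ℤ) → CertTree ((Fin 3 × Fin 3) ⊕ Fin 3)}
    {c w : (Fin 3 × Fin 3) ⊕ Fin 3 → ℤ} (h : entryLeafOKHT5QDX μ P T c w = true) (U : E3 →L[ℝ] E3) (ξ : E3)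
    (hsa : ∀ v v' : E3, ⟪U v, v'⟫ = ⟪v, U v'⟫) (hU : ‖U - 1‖ ≤ 1 / 4)
    (hbox : ∀ ab : Fin 3 × Fin 3, |(U (EuclideanSpace.single ab.2 (1 : ℝ))) ab.1 - (c (Sum.inl ab) : ℝ) / SC| ≤ (w (Sum.inl ab) : ℝ) / SC)
    (hξ : ∀ i : Fin 3, |ξ i - (c (Sum.inr i) : ℝ) / SC| ≤ (w (Sum.inr i) : ℝ) / SC) (h0 : 0 ≤ ξ 0) (h2 : 0 ≤ ξ 2) :
    (∀ (M : ℕ) (z : Fin M → E3) (cc : Fin M), Function.Injective z →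
        Set.range z = {x : E3 | dist x (z cc) ≤ 133 / 10 ∧ ∃ a : Fin 3 → ℤ,
          x = z cc + latPt U hexFrame a ∨ x = z cc + latPt U hexFrame a + U (hcpShift + ξ)} →
        TightNearCap (9 / 5) (3 / 2) z cc ∨ ExemptNear (9 / 5) ExRec z cc ∨ BadNearCap (9 / 5) (3 / 2) z cc) ∨
      (μ : ℝ) / SC ≤ ∑ b ∈ (Fintype.piFinset fun _ : Fin 3 => Finset.Icc (-7 : ℤ) 7).filter (fun b => b ≠ 0), effPot w₄₅ ω₄ (3 / 400) ‖latPt U hexFrame b‖ +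
        ∑ b ∈ (Fintype.piFinset fun _ : Fin 3 => Finset.Icc (-7 : ℤ) 7), effPot w₄₅ ω₄ (3 / 400) ‖latPt U hexFrame b + U (hcpShift + ξ)‖ := by
  simp only [entryLeafOKHT5QDX, Bool.or_eq_true] at h
  rcases h with h | h
  · exact entryLeafOKHT5QD_sound h U ξ hsa hU hbox hξ h0 h2
  · exact entryLeafOKHCCX_sound h U ξ hsa hU hbox hξ h0 h2

/-- ★★ The hcp half from ONE certificate tree over `entryLeafOKHT5QDX μ P T`. [folklore chaining] -/
theorem hcpHalf_of_entryTreeHT5QDX {m : ℝ} {μ : ℤ} (hμ : 2 * (m + (-(7175 / 10000) + 3 / 400)) * SC ≤ μ)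
    (P : ((Fin 3 × Fin 3) ⊕ Fin 3 → ℤ) → ((Fin 3 × Fin 3) ⊕ Fin 3 → ℤ) → HTCert)
    (T : ((Fin 3 × Fin 3) ⊕ Fin 3 → ℤ) → ((Fin 3 × Fin 3) ⊕ Fin 3 → ℤ) → CertTree ((Fin 3 × Fin 3) ⊕ Fin 3))
    {t : CertTree ((Fin 3 × Fin 3) ⊕ Fin 3)} (h : treeOK (entryLeafOKHT5QDX μ P T) t rootCH rootWH = true) :
    ∀ (U : E3 →L[ℝ] E3) (ξ : E3), (∀ v w : E3, inner ℝ (U v) w = inner ℝ v (U w)) → (∀ w : E3, 0 ≤ inner ℝ w (U w)) →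
      ‖U - 1‖ ≤ 1 / 4 → ‖ξ‖ ≤ 1 / 4 → HcpDich m U ξ :=
  hcpHalf_of_entryTreeShuf hμ (entryLeafOKHT5QDX μ P T) (fun _ _ hv U ξ hsa hU hbox hξ h0 h2 => entryLeafOKHT5QDX_sound hv U ξ hsa hU hbox hξ h0 h2) h

/-- ★★★ **`(H) HomFloor (1/625)` OVER THE PRUNED SLAB-WITH-SUB-TREE VERDICT** (`μ = muRec`; any payload functions `P`, `T`). [folklore] -/
theorem homFloor_625_of_entryTrees6RBKP_HT5QDX (P : ((Fin 3 × Fin 3) ⊕ Fin 3 → ℤ) → ((Fin 3 × Fin 3) ⊕ Fin 3 → ℤ) → HTCert)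
    (T : ((Fin 3 × Fin 3) ⊕ Fin 3 → ℤ) → ((Fin 3 × Fin 3) ⊕ Fin 3 → ℤ) → CertTree ((Fin 3 × Fin 3) ⊕ Fin 3))
    (hF : ∃ t : CertTree (Fin 3 × Fin 3), treeOK (entryLeafOK6RBKP muRec) t rootC rootW = true)
    (hH : ∃ t : CertTree ((Fin 3 × Fin 3) ⊕ Fin 3), treeOK (entryLeafOKHT5QDX muRec P T) t rootCH rootWH = true) : HomFloor (1 / 625) := by
  obtain ⟨tF, htF⟩ := hF
  obtain ⟨tH, htH⟩ := hH
  exact homFloor_of_prunedBoxSums_selfAdjoint (fccHalf_of_entryTree6RBKP muRec_ok htF) (hcpHalf_of_entryTreeHT5QDX muRec_ok P T htH)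

end Summit.AtomisticToContinuum.Crystallization.Theorems.FrustratedLawDichotomyStrainedPatchHomEntryLeafHT

end
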